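import Literature.Probability.LatticeModels.KilledGreenLogBounds
import HarnessLib

/-!
# Hitting the origin before leaving a finite planar set: `P^x(ξ_A < τ_0) ≍ a(x)/((1/π) log n)`
# (Lawler 1991, Exercise 1.6.8; Lawler–Limic 2010, Prop. 6.4.1, for general sets)

Topic `Literature/Probability/LatticeModels`; discrete potential theory on `ℤ²`, companion of
`KilledGreenLogBounds.lean`. For a finite `A ⊆ ℤ²` and `x ∈ A ∖ {0}` the probability that simple
random walk from `x` hits `0` before leaving `A` is the mass at `0` of the exit distribution of
`A ∖ {0}`, `P^x(τ_0 < ξ_A) = H_{A∖{0}}(x, 0) = poissonKernel (A.erase 0) x 0`, and optional stopping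
of the martingale `a(S_{t ∧ τ_0 ∧ ξ_A})` (`a` the potential kernel, `Δ a = 2δ₀`, `a(0) = 0`) gives
`a(x) = Σ_{z ∈ ∂A} H_{A∖{0}}(x, z) a(z)`; with `|a(z) - (1/π) log|z| - k₀/2| ≤ C/|z|` on an annulus
of exit points `r ≤ |z| ≤ R` this is the two-sided estimate

* `KozdronLawler.potentialKernel_escape_bounds` —
  **`((1/π) log r + k₀/2 - C/r)·P^x(ξ_A < τ_0) ≤ a(x) ≤ ((1/π) log R + k₀/2 + C/r)·P^x(ξ_A < τ_0)`**,
  `P^x(ξ_A < τ_0) = 1 - poissonKernel (A.erase 0) x 0`; for the disc `C_n` this is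
  `P^x{ξ_n < τ_0} = a(x)/((1/π) log n + k₀/2 + O(n⁻¹))` (Lawler 1991, Exercise 1.6.8, with his
  `a = 2 ·` ours).

No named fact is introduced.

## References

* G. F. Lawler, *Intersections of Random Walks* (1991), §1.6 (Exercise 1.6.8) [Lawler1991].
* G. F. Lawler, V. Limic, *Random Walk: A Modern Introduction* (2010), Prop. 6.4.1 [LawlerLimic2010].
-/

noncomputable section

open Finset

namespace Literature.Probability.LatticeModels

namespace KozdronLawler

/-- The exit distribution `H_Λ(x, ·)` is carried by the outer boundary `∂Λ`. [folklore] -/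
theorem poissonKernel_of_not_mem_outerBoundary {d : ℕ} (Λ : Finset (Site d)) (x : Site d)
    {z : Site d} (hz : z ∉ outerBoundary (zdGraph d) Λ) : poissonKernel Λ x z = 0 := by
  classical
  unfold poissonKernel
  split_ifs with hzΛ
  · rfl
  · refine Finset.sum_eq_zero fun w hw => dirichletGreen_of_not_mem_right Λ x fun hwΛ => hz ?_
    exact mem_outerBoundary_iff.2 ⟨hzΛ, w, hwΛ, (SimpleGraph.mem_neighborFinset _ _ _).1 hw⟩

/-- **`P^x(ξ_A < τ_0) ≍ a(x)/((1/π) log dist(0,∂A) + k₀/2)`, two-sided** (Lawler 1991, Ex. 1.6.8;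
Lawler–Limic 2010, Prop. 6.4.1, for the disc): there is `C` such that for every finite `A ⊆ ℤ²`,
every `x ∈ A ∖ {0}` and all `r ≥ 1`, `R` with `r ≤ |z| ≤ R` for every exit point `z ∈ ∂A`,
`((1/π) log r + k₀/2 - C/r)(1 - H_{A∖{0}}(x,0)) ≤ a(x) ≤ ((1/π) log R + k₀/2 + C/r)(1 - H_{A∖{0}}(x,0))`,
where `1 - H_{A∖{0}}(x,0) = 1 - poissonKernel (A.erase 0) x 0 = P^x(ξ_A < τ_0)` is the probability of
leaving `A` before hitting the origin. [cite: Lawler1991, §1.6 Exercise 1.6.8] -/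
theorem potentialKernel_escape_bounds : ∃ C : ℝ, ∀ A : Finset (Site 2), ∀ x ∈ A, x ≠ 0 →
    ∀ r R : ℝ, 1 ≤ r →
      (∀ z ∈ outerBoundary (zdGraph 2) A, r ≤ ‖Site.toComplex z‖ ∧ ‖Site.toComplex z‖ ≤ R) →
      (1 / Real.pi * Real.log r + greenConst / 2 - C / r) * (1 - poissonKernel (A.erase 0) x 0) ≤
          latticePotentialKernel 2 x ∧
        latticePotentialKernel 2 x ≤
          (1 / Real.pi * Real.log R + greenConst / 2 + C / r) * (1 - poissonKernel (A.erase 0) x 0) := by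
  classical
  obtain ⟨C₀, hC₀⟩ := latticePotentialKernel_two_rate
  refine ⟨|C₀|, fun A x hx hx0 r R hr hann => ?_⟩
  set A' : Finset (Site 2) := A.erase 0 with hA'
  have hx' : x ∈ A' := Finset.mem_erase.2 ⟨hx0, hx⟩
  -- optional stopping of `a(S)` on `A ∖ {0}`: `a(x) = Σ_{z ∈ ∂A'} H_{A'}(x,z) a(z)`
  have hrep := green_representation (by norm_num : 0 < 2) A' (latticePotentialKernel 2) hx'
  have hsum0 : ∑ y ∈ A', dirichletGreen A' x y * -latticeLaplacianZd (latticePotentialKernel 2) y = 0 := by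
    refine Finset.sum_eq_zero fun y hy => ?_
    have hy0 : y ≠ 0 := (Finset.mem_erase.1 hy).1
    rw [latticeLaplacianZd_latticePotentialKernel 2 (by norm_num) y, if_neg hy0]
    ring
  rw [hsum0, zero_add] at hrep
  set S' := outerBoundary (zdGraph 2) A' with hS'
  set H' : Site 2 → ℝ := fun z => poissonKernel A' x z with hH'
  have hH0 : ∀ z, 0 ≤ H' z := fun z => poissonKernel_nonneg (by norm_num) A' x z
  have hS1 : ∑ z ∈ S', H' z = 1 := sum_poissonKernel (by norm_num) A' hx'
  -- the exit points of `A'` other than `0` are exit points of `A`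
  have hmem : ∀ z ∈ S'.erase 0, z ∈ outerBoundary (zdGraph 2) A := by
    intro z hz
    obtain ⟨hz0, hzS⟩ := Finset.mem_erase.1 hz
    obtain ⟨hzA', y, hyA', hadj⟩ := mem_outerBoundary_iff.1 hzS
    exact mem_outerBoundary_iff.2
      ⟨fun hzA => hzA' (Finset.mem_erase.2 ⟨hz0, hzA⟩), y, (Finset.mem_erase.1 hyA').2, hadj⟩
  -- drop the `0` term (`a(0) = 0`) and compute the remaining mass `1 - H'(0)`
  have hsplit_a : ∑ z ∈ S', H' z * latticePotentialKernel 2 z =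
      ∑ z ∈ S'.erase 0, H' z * latticePotentialKernel 2 z := by
    rw [Finset.sum_erase]
    rw [latticePotentialKernel_zero, mul_zero]
  have hsplit_1 : ∑ z ∈ S'.erase 0, H' z = 1 - H' 0 := by
    by_cases h0S : (0 : Site 2) ∈ S'
    · rw [Finset.sum_erase_eq_sub h0S, hS1]
    · rw [Finset.erase_eq_of_notMem h0S, hS1]
      have h00 : H' 0 = 0 := poissonKernel_of_not_mem_outerBoundary A' x h0S
      rw [h00, sub_zero]
  -- bounds for `a` on the exit points
  have hz : ∀ z ∈ S'.erase 0,
      1 / Real.pi * Real.log r + greenConst / 2 - |C₀| / r ≤ latticePotentialKernel 2 z ∧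
        latticePotentialKernel 2 z ≤ 1 / Real.pi * Real.log R + greenConst / 2 + |C₀| / r :=
    fun z hzS => potentialKernel_mem_of_annulus hr hC₀ (hann z (hmem z hzS)).1 (hann z (hmem z hzS)).2
  have hlow : ∑ z ∈ S'.erase 0, H' z * (1 / Real.pi * Real.log r + greenConst / 2 - |C₀| / r) ≤
      ∑ z ∈ S'.erase 0, H' z * latticePotentialKernel 2 z :=
    Finset.sum_le_sum fun z hzS => mul_le_mul_of_nonneg_left (hz z hzS).1 (hH0 z)
  have hupp : ∑ z ∈ S'.erase 0, H' z * latticePotentialKernel 2 z ≤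
      ∑ z ∈ S'.erase 0, H' z * (1 / Real.pi * Real.log R + greenConst / 2 + |C₀| / r) :=
    Finset.sum_le_sum fun z hzS => mul_le_mul_of_nonneg_left (hz z hzS).2 (hH0 z)
  rw [← Finset.sum_mul, hsplit_1] at hlow hupp
  rw [hrep, hsplit_a]
  constructor
  · rw [mul_comm]; exact hlow
  · rw [mul_comm]; exact hupp

end KozdronLawler

end Literature.Probability.LatticeModels

end
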